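import Summits.ABC.IUTFork.Cor312PilotIdelesMNumbers
import Summits.ABC.IUTFork.Cor312PilotIdelesM
import HarnessLib

/-!
# [IUTchIII] Corollary 3.12 — the NUMBER `−|log(q)|` and the PROVENANCE LINK at abc-iut-s2-p8's SUMMAND-ROUTE sharp M-level setting
# `settingPrVolSharpM` with the genuine `q`-ideles; volume-input forms (G1-Θ unit P5-numbers, sequel)

PROOF-ONLY record file (D-0012; no definitions) of the abc-iut cell (seat abc-iut-w5-d244, gen 8; branch C «abc ⇐ S», C-lead ruling
C-R12 (e) «target #2′»). TAKES NO SIDE on [IUTchIII] Cor. 3.12. Sequel of this seat's `Cor312PilotIdelesMNumbers` (p439939), which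
computed `−|log(q)|` ([IUTchIII] Cor. 3.12, kurims `paper:url-4b091feeb646` p. 174 l. 4–13; [IUTchIV] Thm. 1.10 p. 23 "`|log(q)| =
(1/2l)·log(q)`") at abc-iut-w4-d013's summand-route `settingPrVolM … (qCentreM tq) …` and at abc-iut-w5-d166's frames-route
`settingMSharp`. The branch-C certificate v8 (abc-iut-C-cert-3, `Conditional/AbcOfSGenuineMOrbit`) sits at abc-iut-s2-p8's
SUMMAND-ROUTE SHARP setting `Real.settingPrVolSharpM` (`Cor312PilotIdelesM`, p438078) — DEFINITIONALLY `settingPrVolM` at the sharp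
Θ-boxes `thetaBoxM t` and `q`-centre `qCentreM tq` — and keeps «[PROV] `Cor312Prov.IsSettingOf T.D P`» NAMED. THIS FILE discharges it:

* `negLogQ_settingPrVolSharpM` — `P.negLogQ = −deĝ_{F_mod}(Q)` for `q`-ideles realising any divisor `Q` (p439939's
  `negLogQ_settingPrVolM_qCentreM`, read at `settingPrVolSharpM` by `rfl`-unfolding);
* the GENUINE instance `tq := tqM` (abc-iut-w5-d033's idele read-off, `Cor312PilotIdelesMRead`; realisation `log_norm_tqM` and
  non-vanishing `tqM_ne_zero` are theorems; the «units off a finite `Sq`» binder is kept free — dischargeable by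
  `Cor312PilotIdelesMReadRat.norm_tqM_eq_one_of_not_mem_image`): `negLogQ_settingPrVolSharpM_tqM = −deĝ_{F_mod}(P_q)`,
  `… = (volumeInputOf D r).negAbsLogQ` (abc-iut-S2), `… = −absLogq D` (abc-iut-c312-8), **`isSettingOf_settingPrVolSharpM_tqM :
  Cor312Prov.IsSettingOf D (settingPrVolSharpM …)`** (c312-8 `isSettingOf_ofInitial`), `absLogQPos_settingPrVolSharpM_tqM`;
* volume-input forms on both routes: for a genuine Θ-volume input `I` OF `D` (`IsVolumeInputOf D I`) with the datum's OWN
  `q`-ideles `tqM … (ideleDataOf D hI)`: **`negLogQ_settingPrVolSharpM_ideleDataOf_eq_negAbsLogQ`**,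
  **`negLogQ_settingMSharp_ideleDataOf_eq_negAbsLogQ`** : `P.negLogQ = I.negAbsLogQ` (abc-iut-w5-d033 `negAbsLogQ_eq_ideleDataOf`).

[cite: Mochizuki2012, IUTchIII Cor. 3.12 p. 174] [cite: Mochizuki2012, IUTchIV Thm. 1.10 p. 23] [cite: DupuyHilado2025, §3.4, §3.9, Thm. 3.10.1]
[claim: Mochizuki2012, status: disputed] for the quoted sentences. HONEST FRAMING: a computation of ONE printed quantity at the M-level
instantiation and the index/number provenance it implies; nothing here bears on `−|log(Θ)|` or on the inequality of Cor. 3.12;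
no edit to any other seat's file; typed ≠ proved; instantiated ≠ endorsed.
-/

noncomputable section

open Set Function NumberField IsDedekindDomain
open scoped Pointwise

namespace Summit.ABC.IUTFork.Thm311.Real

open Cor312 Cor312Vol Cor312Prov Literature.IUT.LogThetaLattice Literature.IUT.LogVolume Literature.IUT.HodgeTheaters
  Literature.NumberTheory.NumberFields

variable {F K Fbar : Type} [Field F] [NumberField F] [Field K] [NumberField K] [Algebra F K]
  [Field Fbar] [Algebra F Fbar] [Algebra K Fbar] {E : WeierstrassCurve F} [E.IsElliptic] {l : ℕ}
  {Pb : BadPlacePredicates K} (D : InitialThetaData F K Fbar E l Pb) {logvK : PadicLogsVal K}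
  (hlog : LogvAnalyticVal logvK)

/-! ## §1. The summand-route sharp setting `settingPrVolSharpM` (abc-iut-s2-p8) -/

section Summand

variable (M : Type) [Field M] [NumberField M]
  (archPk : ∀ (j : (thetaIndexOfInitial D).Label) (vQ : (thetaIndexOfInitial D).VQ),
    Set ((logShellsOfInitialDH D logvK).Packet j vQ))
  (archSub : ∀ (j : (thetaIndexOfInitial D).Label) (v : (thetaIndexOfInitial D).V),
    Set ((logShellsOfInitialDH D logvK).Packet j ((thetaIndexOfInitial D).over v)))
  (Ψ : ℤ → ∀ v : (thetaIndexOfInitial D).V, v ∈ (thetaIndexOfInitial D).Vbad →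
    Set ((logShellsOfInitialDH D logvK).StarPacket v))
  (act : ℤ → ∀ v : (thetaIndexOfInitial D).V, v ∈ (thetaIndexOfInitial D).Vbad →
    (logShellsOfInitialDH D logvK).StarPacket v → Module.End ℚ ((logShellsOfInitialDH D logvK).StarPacket v))
  (Mmod : ℤ → ∀ j : (thetaIndexOfInitial D).LabelStar, Set ((logShellsOfInitialDH D logvK).GlobalPacket j.1))
  (region : ℤ → ∀ j : (thetaIndexOfInitial D).LabelStar, FinDivisor M → ∀ vQ : (thetaIndexOfInitial D).VQ,
    Set ((logShellsOfInitialDH D logvK).Packet j.1 vQ))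
  (n : ℤ) {HT : Type} {LogLink : HT → HT → Type} {IsFull : ∀ {s t : HT}, LogLink s t → Prop}
  (lat : LGPGaussianLogThetaLattice LogLink IsFull)
  {Frd : Type} {IsoF : Frd → Frd → Type} {Ob : Frd → Type} {realify : Frd → Frd} {Strip : Type}
  {IsoS : Strip → Strip → Type}
  {Mv : ∀ v : (thetaIndexOfInitial D).V, v ∈ (thetaIndexOfInitial D).Vbad → Type} [∀ v h, Monoid (Mv v h)]
  (sig : GlobalLGPFrobenioidSignature (thetaIndexOfInitial D).lstar (thetaIndexOfInitial D).V
    (· ∈ (thetaIndexOfInitial D).Vbad) Frd IsoF Ob realify Strip IsoS Mv)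
  (split : SplittingMonoids Mv) {ObΔ : Type}
  {N : ∀ v : (thetaIndexOfInitial D).V, v ∈ (thetaIndexOfInitial D).Vbad → Type} [∀ v h, Monoid (N v h)]
  (qData : QPilotData ObΔ N)
  (t : ∀ (u : FinitePlace ℚ) (_ : Fin (thetaIndexOfInitial D).lstar) (x : (thetaIndexOfInitial D).Fibre (Val.non u)),
    kOfM D (ratChar u) u (natCast_ratChar_mem u) x)

/-- **`−|log(q)| = −deĝ_{F_mod}(Q)` at abc-iut-s2-p8's SUMMAND-ROUTE sharp setting `settingPrVolSharpM`** (= `settingPrVolM` at the sharp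
binders, definitionally; §3 read there) for `q`-ideles realising ANY divisor `Q` on the finite places of `F_mod`.
[cite: DupuyHilado2025, Thm. 3.10.1] -/
theorem negLogQ_settingPrVolSharpM
    (tq : ∀ (u : FinitePlace ℚ) (x : (thetaIndexOfInitial D).Fibre (Val.non u)), kOfM D (ratChar u) u (natCast_ratChar_mem u) x)
    (htq0 : ∀ u x, tq u x ≠ 0) (Sq : Finset (FinitePlace ℚ))
    (htq1 : ∀ (u : FinitePlace ℚ) (x : (thetaIndexOfInitial D).Fibre (Val.non u)), u ∉ Sq → ‖tq u x‖ = 1)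
    (Q : HeightOneSpectrum (𝓞 (fieldOfModuli E)) →₀ ℝ)
    (htq : ∀ (u : FinitePlace ℚ) (x : (thetaIndexOfInitial D).Fibre (Val.non u)),
      Real.log ‖tq u x‖ = -(Q (placeModOfM D u x)) * logNorm (fieldOfModuli E) (placeModOfM D u x) /
        localDegree (fieldOfModuli E) (placeModOfM D u x)) :
    (settingPrVolSharpM D hlog t tq M archPk archSub Ψ act Mmod region n lat sig split qData htq0 Sq htq1).negLogQ =
      -FinDivisor.ndeg (fieldOfModuli E) Q :=
  negLogQ_settingPrVolM_qCentreM D hlog M archPk archSub Ψ act Mmod region n lat sig split qData _ tq htq0 _ Q htq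

variable (r : ThetaData.IdeleData D) (Sq : Finset (FinitePlace ℚ))
  (htq1 : ∀ (u : FinitePlace ℚ) (x : (thetaIndexOfInitial D).Fibre (Val.non u)), u ∉ Sq →
    ‖tqM D (ratChar u) u (natCast_ratChar_mem u) r x‖ = 1)

/-- **`−|log(q)| = −deĝ_{F_mod}(P_q)` for the GENUINE `q`-ideles of `D` at the summand-route sharp setting** (`tq := tqM` of the idele
data `r`; realisation and non-vanishing are theorems of abc-iut-w5-d033's P4a). [cite: Mochizuki2012, IUTchIV Thm. 1.10 p. 23] -/
theorem negLogQ_settingPrVolSharpM_tqM :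
    (settingPrVolSharpM D hlog t (fun u x => tqM D (ratChar u) u (natCast_ratChar_mem u) r x) M archPk archSub Ψ act Mmod region n
        lat sig split qData (fun u x => tqM_ne_zero D (ratChar u) u (natCast_ratChar_mem u) r x) Sq htq1).negLogQ =
      -FinDivisor.ndeg (fieldOfModuli E) (ThetaData.pilotData D).qPilot :=
  negLogQ_settingPrVolSharpM D hlog M archPk archSub Ψ act Mmod region n lat sig split qData t _ _ Sq htq1
    (ThetaData.pilotData D).qPilot (fun u x => log_norm_tqM D (ratChar u) u (natCast_ratChar_mem u) r x)

/-- … `= −|log(q)|` of abc-iut-S2's genuine input `volumeInputOf D r` — the `q`-sides are ONE number (summand route).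
[cite: Mochizuki2012, IUTchIV Thm. 1.10 p. 23] -/
theorem negLogQ_settingPrVolSharpM_tqM_eq_negAbsLogQ :
    (settingPrVolSharpM D hlog t (fun u x => tqM D (ratChar u) u (natCast_ratChar_mem u) r x) M archPk archSub Ψ act Mmod region n
        lat sig split qData (fun u x => tqM_ne_zero D (ratChar u) u (natCast_ratChar_mem u) r x) Sq htq1).negLogQ =
      (ThetaData.volumeInputOf D r).negAbsLogQ := by
  rw [negLogQ_settingPrVolSharpM_tqM, (ThetaData.isVolumeInputOf_volumeInputOf D r).negAbsLogQ_eq]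

/-- … `= −(1/2l)·log(q)` of the initial Θ-data (`−absLogq D`, abc-iut-c312-8). [cite: Mochizuki2012, IUTchIV Thm. 1.10 p. 23] -/
theorem negLogQ_settingPrVolSharpM_tqM_eq_neg_absLogq :
    (settingPrVolSharpM D hlog t (fun u x => tqM D (ratChar u) u (natCast_ratChar_mem u) r x) M archPk archSub Ψ act Mmod region n
        lat sig split qData (fun u x => tqM_ne_zero D (ratChar u) u (natCast_ratChar_mem u) r x) Sq htq1).negLogQ = -absLogq D := by
  rw [negLogQ_settingPrVolSharpM_tqM_eq_negAbsLogQ]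
  exact negAbsLogQ_eq_neg_absLogq_of_isVolumeInputOf D (ThetaData.isVolumeInputOf_volumeInputOf D r)

/-- **THE M-LEVEL PROVENANCE LINK for abc-iut-s2-p8's summand-route sharp setting with the genuine `q`-ideles** — the «[PROV]»
binder `Cor312Prov.IsSettingOf T.D P` of the branch-C certificate v8 (`Conditional/AbcOfSGenuineMOrbit`, abc-iut-C-cert-3) as a
THEOREM (c312-8's `isSettingOf_ofInitial` + the preceding number). [claim: Mochizuki2012, status: disputed] -/
theorem isSettingOf_settingPrVolSharpM_tqM :
    IsSettingOf D (settingPrVolSharpM D hlog t (fun u x => tqM D (ratChar u) u (natCast_ratChar_mem u) r x) M archPk archSub Ψ act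
      Mmod region n lat sig split qData (fun u x => tqM_ne_zero D (ratChar u) u (natCast_ratChar_mem u) r x) Sq htq1) :=
  isSettingOf_ofInitial D _ (negLogQ_settingPrVolSharpM_tqM_eq_neg_absLogq D hlog M archPk archSub Ψ act Mmod region n lat sig
    split qData t r Sq htq1)

/-- "`|log(q)| > 0`" at the summand-route sharp setting with the genuine `q`-ideles. [claim: Mochizuki2012, status: disputed] -/
theorem absLogQPos_settingPrVolSharpM_tqM :
    (settingPrVolSharpM D hlog t (fun u x => tqM D (ratChar u) u (natCast_ratChar_mem u) r x) M archPk archSub Ψ act Mmod region n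
        lat sig split qData (fun u x => tqM_ne_zero D (ratChar u) u (natCast_ratChar_mem u) r x) Sq htq1).AbsLogQPos :=
  (absLogQPos_iff _ (isSettingOf_settingPrVolSharpM_tqM D hlog M archPk archSub Ψ act Mmod region n lat sig split qData t r Sq htq1)
    (by have := D.five_le_l; omega)).mpr (logq_pos D)

/-! ## §2. Volume-input forms: the idele data OF a genuine Θ-volume input `I` of `D` (abc-iut-w5-d033's `ideleDataOf`) -/

/-- **`−|log(q)|` of the summand-route sharp setting built from a genuine Θ-volume input `I` OF `D` IS `I.negAbsLogQ`** (the datum's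
`q`-ideles `tqM … (ideleDataOf D hI)`; `I = volumeInputOf D (ideleDataOf D hI)`, abc-iut-w5-d033 `negAbsLogQ_eq_ideleDataOf`) — the
shape in which the branch-C per-datum structures carry the input. [cite: Mochizuki2012, IUTchIV Thm. 1.10 p. 23] -/
theorem negLogQ_settingPrVolSharpM_ideleDataOf_eq_negAbsLogQ {I : ThetaVolumeInput (fieldOfModuli E) K}
    (hI : ThetaData.IsVolumeInputOf D I)
    (htq1' : ∀ (u : FinitePlace ℚ) (x : (thetaIndexOfInitial D).Fibre (Val.non u)), u ∉ Sq →
      ‖tqM D (ratChar u) u (natCast_ratChar_mem u) (ideleDataOf D hI) x‖ = 1) :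
    (settingPrVolSharpM D hlog t (fun u x => tqM D (ratChar u) u (natCast_ratChar_mem u) (ideleDataOf D hI) x) M archPk archSub Ψ
        act Mmod region n lat sig split qData (fun u x => tqM_ne_zero D (ratChar u) u (natCast_ratChar_mem u) (ideleDataOf D hI) x)
        Sq htq1').negLogQ = I.negAbsLogQ := by
  rw [negLogQ_settingPrVolSharpM_tqM_eq_negAbsLogQ, ← negAbsLogQ_eq_ideleDataOf D hI]

/-- The same at the FRAMES-route sharp setting `settingMSharp`. [cite: Mochizuki2012, IUTchIV Thm. 1.10 p. 23] -/
theorem negLogQ_settingMSharp_ideleDataOf_eq_negAbsLogQ {I : ThetaVolumeInput (fieldOfModuli E) K}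
    (hI : ThetaData.IsVolumeInputOf D I)
    (htq1' : ∀ (u : FinitePlace ℚ) (x : (thetaIndexOfInitial D).Fibre (Val.non u)), u ∉ Sq →
      ‖tqM D (ratChar u) u (natCast_ratChar_mem u) (ideleDataOf D hI) x‖ = 1) :
    (settingMSharp D hlog M archPk archSub Ψ act Mmod region n lat sig split qData t
        (fun u x => tqM D (ratChar u) u (natCast_ratChar_mem u) (ideleDataOf D hI) x)
        (fun u x => tqM_ne_zero D (ratChar u) u (natCast_ratChar_mem u) (ideleDataOf D hI) x) Sq htq1').negLogQ = I.negAbsLogQ := by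
  rw [negLogQ_settingMSharp_tqM_eq_negAbsLogQ, ← negAbsLogQ_eq_ideleDataOf D hI]

end Summand

end Summit.ABC.IUTFork.Thm311.Real

end
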